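import Literature.AnabelianGeometry.EtaleTheta.GalSectDotCCuspDecompCriterionChiInv
import Literature.AnabelianGeometry.EtaleTheta.ThetaCohomologyCuspSectionPoints
import Literature.AnabelianGeometry.EtaleTheta.GalSectSplittingsCohomologyChi
import Literature.AnabelianGeometry.EtaleTheta.SettingModelChiCuspInertiaNotTheta
import HarnessLib

/-!
# The `b`-AXIS CUSP PROFILE of the χ-twisted model `modelχ′` — one citable conjunction of what the synthetic cusp
# SERVES and what it does NOT (NV-L2 census, R78 cusp lineage)

S. Mochizuki, *The étale theta function …* [EtTh], Publ. RIMS **45** (2009), §1 p. 13 («any decomposition group of a cusp of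
`Y^log`»), Prop. 1.4 (iii) p. 22, §2 p. 35 («`D_x → Π^Θ_X` … maps the inertia group `I_x ⊆ D_x` isomorphically onto `Δ_Θ`»),
Thm. 1.10 (iii) p. 30 [cite: MochizukiEtTh2009, §1 p.13]; S. Mochizuki, *Galois sections …* [GalSect] §4 p. 33
[cite: MochizukiGalSect2005, §4 p.33].  abc-iut cell, layer L2, seat abc-iut-w5-d029 (gen 5).  PROOF-ONLY (0 definitions): a census
CONJUNCTION, every conjunct a landed theorem cited BY NAME (this seat's p429840 / p433756 / p432832 / p443548 / ChiInv companion;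
abc-iut-L2-t10's `SettingModelChiCuspInertiaNotTheta`; abc-iut-w5-d140's `inversionModelχ′`).

`cuspProfile_modelχ'` — at `ThetaSetting.modelχ′ p` (one synthetic cusp with decomposition group `b^Ẑ ⋊ G_{ℚ_p}`):
SERVED — (P1) `Ker(Π_X → G) = Δ_X`, (P2) a cusp exists, (P3) `D_x ≤ Π^tp_Y`, (P4) `D_x ↠ G_K`, the guard `IsEtThOrigin`, a
continuous section into `D_x` whose image is a closed splitting ([GalSect] §4 torsor), an ANCHORED cuspidal `K̈`-point of `Ÿ` on
label `0` (Prop. 1.4 (iii) cusp clause carrier);  NOT SERVED — the §2 inertia clause «`I_x ⥲ Δ̄_Θ`» in its §1-side form `toHat(I_x) ⊔ barKerOf Δ_X l =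
barThetaOf Δ_X l`, every `l ≥ 2` (abc-iut-L2-t10's `not_inertiaClause_curveχ'`, p433801), and [EtTh] Thm. 1.10 (iii)'s cusp data: `MuTwoSetting.DotCCusp` / `DotCCuspTorsor` are EMPTY
over the Def. 1.7 record `inversionModelχ′` for every admissible `ε_Z` (the cusp is ramified in `Ẍ → X`).
READING: the Tate-twisted `b`-axis is Galois-theoretically the right line (`≅ Ẑ(1)`, `K`-rational, inside `Π^tp_Y`) but
geometrically the wrong one (print's inertia is the boundary commutator `⁅a,b⁆^Ẑ ≤ Δ^tp_Ẍ`); every §1 clause that reads only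
`(D_x ↠ G_K, I_x ≅ Ẑ(1), D_x ≤ Π^tp_Y)` is witnessed, every clause that reads the POSITION of `I_x` in `Δ_X` fails.
Semi-synthetic model; consistency/inconsistency evidence for the typed interfaces only; nothing of [EtTh]/[GalSect] asserted; no side
taken on [IUTchIII] Cor. 3.12; typed ≠ proved.
-/

noncomputable section

namespace Literature.AnabelianGeometry.EtaleTheta.SettingModel

open Literature.AnabelianGeometry.SemiGraphs GalSect ThetaSetting ClassTwoBar

variable (p : ℕ) [Fact p.Prime]

/-- **The `b`-axis cusp profile of `modelχ′`** (SERVED ∧ NOT SERVED, every conjunct by name).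
[cite: MochizukiEtTh2009, §1 p.13] -/
theorem cuspProfile_modelχ' :
    -- SERVED
    ((ThetaSetting.modelχ' p).IsEtThOrigin ∧
      (ThetaSetting.modelχ' p).augHat.toMonoidHom.ker = (ThetaSetting.modelχ' p).DeltaHat ∧
      (∃ x : (ThetaSetting.modelχ' p).Pt, (ThetaSetting.modelχ' p).IsCusp x) ∧
      (∀ x : (ThetaSetting.modelχ' p).Pt, (ThetaSetting.modelχ' p).decomp x ≤ (ThetaSetting.modelχ' p).toZ.ker) ∧
      (∀ x : (ThetaSetting.modelχ' p).Pt,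
        ((ThetaSetting.modelχ' p).decomp x).map (ThetaSetting.modelχ' p).aug.toMonoidHom = (ThetaSetting.modelχ' p).GK) ∧
      (∃ s : GQp p →ₜ* PiTpχ p, (∀ σ, augχ p (s σ) = σ) ∧ (∀ σ, s σ ∈ (curveχ' p).decomp ()) ∧
        s.toMonoidHom.range ∈ (cuspPairOf (curveχ' p) ()).splittings) ∧
      (∃ (E : (ThetaSetting.modelχ' p).KummerData) (y : CuspidalPointDd E), y.IsAnchored ∧ y.IsOnLabelZero)) ∧
    -- NOT SERVED
    ((∀ l : ℕ, 2 ≤ l → ∀ x : (curveχ' p).Pt,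
        ¬ (((curveχ' p).inertia x).map (curveχ' p).toHat.toMonoidHom ⊔ barKerOf (curveχ' p).DeltaHat l =
            barThetaOf (curveχ' p).DeltaHat l)) ∧
      (∀ εZ : (MuTwoSetting.inversionModelχ' p).GtpC, (MuTwoSetting.inversionModelχ' p).IsAdmissibleEpsZ εZ →
        IsEmpty ((MuTwoSetting.inversionModelχ' p).DotCCusp εZ) ∧ IsEmpty ((MuTwoSetting.inversionModelχ' p).DotCCuspTorsor εZ))) :=
  ⟨⟨ThetaSetting.modelχ'_isEtThOrigin p, ker_augHat_modelχ' p, exists_isCusp_modelχ' p, decomp_modelχ'_le_ker_toZ p,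
      map_aug_decomp_modelχ' p, exists_continuous_section_cuspχ p,
      ⟨kummerDataχ'Sec p, cuspidalPointDdχ' p, cuspidalPointDdχ'_isAnchored p, cuspidalPointDdχ'_isOnLabelZero p⟩⟩,
    ⟨fun l hl x => not_inertiaClause_curveχ' p l hl x,
      fun _ hZ => ⟨isEmpty_dotCCusp_inversionModelχ' p hZ, isEmpty_dotCCuspTorsor_inversionModelχ' p hZ⟩⟩⟩

end Literature.AnabelianGeometry.EtaleTheta.SettingModel

end
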